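import Mathlib
import HarnessLib

/-!
# Route `GenusKolyvaginAtTwo`, crux L_T `PowDvdShaCardAtTwoRT` (stmt-BirchSwinnertonDyer-23242), LINE 18/19 stub 3a⁗, step (b)
# TOOLBOX: the RANK hypothesis of the prime-swapping loop — a subgroup on `k` generators has `#C[p] = p^d`, `d ≤ k`

Seat `bsd-line-gk2-p2` g15, `--supports 23242 --as helper`; sequel of `…RTPrimeSwapping` (`exists_good_separating_of_swapOracle`
asks for `#(C ∩ V[p]) = p^d` with `d ≤ r`; McCallum's Prop. 5.2 has «`C` a subgroup of rank `r`», and in the ladder `C = ⟨s⟩` for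
`#s ≤ r` classes). Mathlib-only algebra; THEOREMS ONLY. BSD is not proved by any of this.

* `natCard_eq_natCard_inf_ker_mul_natCard_map` — `#T = #(T ∩ ker π) · #π(T)`;
* `natCard_dvd_of_le_zmultiples_of_nsmul_eq_zero` — a `p`-torsion subgroup of a cyclic group has order `∣ p`;
* `exists_natCard_closure_inf_torsionBy_eq_pow` — for `s ⊆ R` (`R` a finite subgroup), `#(⟨s⟩ ∩ V[p]) = p^d` with `d ≤ #s`.

References: [McCallumLMS1991] §5 Prop. 5.2 («a subgroup of rank `r`»).
-/

-- `Summit.<P>.<Sub>` repeats `BirchSwinnertonDyer` by the tree's layout convention (D-0017)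
set_option linter.dupNamespace false

namespace Summit.BirchSwinnertonDyer.BirchSwinnertonDyer.Theorems.GenusExact.PlusDescent

open AddSubgroup Finset

/-! ## The rank hypothesis: a subgroup on `k` generators has `#C[p] ∣ p^k` -/

section Rank

variable {V : Type*} [AddCommGroup V]

/-- Kernel–image count: `#T = #(T ∩ ker π) · #π(T)` for a subgroup `T` and a homomorphism `π`. [folklore] -/
theorem natCard_eq_natCard_inf_ker_mul_natCard_map {W : Type*} [AddCommGroup W] (π : V →+ W) (T : AddSubgroup V) :
    Nat.card T = Nat.card ↥(T ⊓ π.ker) * Nat.card (T.map π) := by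
  set f : T →+ W := π.comp T.subtype with hf
  have hker : Nat.card f.ker = Nat.card ↥(T ⊓ π.ker) := by
    refine Nat.card_congr ⟨fun x ↦ ⟨(x : T), ⟨(x : T).2, ?_⟩⟩, fun y ↦ ⟨⟨y, y.2.1⟩, ?_⟩, fun _ ↦ rfl, fun _ ↦ rfl⟩
    · have h := x.2
      rw [AddMonoidHom.mem_ker] at h
      exact h
    · rw [AddMonoidHom.mem_ker]
      exact y.2.2
  have hrange : f.range = T.map π := by rw [hf, AddMonoidHom.range_comp, AddSubgroup.range_subtype]
  rw [← hker, ← hrange, ← AddSubgroup.index_ker, AddSubgroup.card_mul_index]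

/-- A subgroup of a cyclic group which is killed by the prime `p` has order dividing `p`. [folklore] -/
theorem natCard_dvd_of_le_zmultiples_of_nsmul_eq_zero {W : Type*} [AddCommGroup W] {p : ℕ} (hp : p.Prime) {y : W}
    {Q : AddSubgroup W} (hQ : Q ≤ AddSubgroup.zmultiples y) (hpQ : ∀ q ∈ Q, p • q = 0) :
    Nat.card Q ∣ p := by
  haveI : IsAddCyclic Q := by
    haveI : IsAddCyclic (AddSubgroup.zmultiples y) := isAddCyclic_zmultiples y
    exact isAddCyclic_of_injective (AddSubgroup.inclusion hQ) (AddSubgroup.inclusion_injective hQ)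
  have hexp : AddMonoid.exponent Q ∣ p :=
    AddMonoid.exponent_dvd_of_forall_nsmul_eq_zero fun q ↦ Subtype.ext (by
      rw [AddSubgroupClass.coe_nsmul, ZeroMemClass.coe_zero]; exact hpQ q q.2)
  have hfin : Finite Q := by
    refine Nat.finite_of_card_ne_zero ?_
    rw [← IsAddCyclic.exponent_eq_card]
    exact fun h ↦ hp.ne_zero (Nat.eq_zero_of_zero_dvd (h ▸ hexp))
  rw [← IsAddCyclic.exponent_eq_card]
  exact hexp

/-- **A subgroup generated by `k` elements of a finite abelian group has `#C[p] = p^d` with `d ≤ k`** (its `p`-rank is at most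
the number of generators): the rank hypothesis `hd`, `hdr` of `exists_good_separating_of_swapOracle` for `C = ⟨s⟩`, `#s ≤ r` — in
McCallum's Prop. 5.2 «`C` a subgroup of rank `r`». Induction on `s`: adjoining `x` to `C′` changes `#C[p]` by a factor `1` or `p`,
because `(C[p] + C′)/C′` is a `p`-torsion subgroup of the cyclic group `(C′ + ℤx)/C′`. [folklore] -/
theorem exists_natCard_closure_inf_torsionBy_eq_pow {p : ℕ} (hp : p.Prime) (R : AddSubgroup V) [Finite R]
    (s : Finset V) (hs : (↑s : Set V) ⊆ R) :
    ∃ d ≤ s.card, Nat.card ↥(AddSubgroup.closure (↑s : Set V) ⊓ AddSubgroup.torsionBy V (p : ℤ)) = p ^ d := by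
  classical
  induction s using Finset.induction_on with
  | empty =>
    refine ⟨0, le_rfl, ?_⟩
    rw [Finset.coe_empty, AddSubgroup.closure_empty, bot_inf_eq, AddSubgroup.card_bot, pow_zero]
  | @insert x s hx ih =>
    obtain ⟨d', hd', hcard'⟩ := ih ((Finset.coe_subset.mpr (Finset.subset_insert x s)).trans hs)
    set C' : AddSubgroup V := AddSubgroup.closure (↑s : Set V) with hC'
    set C : AddSubgroup V := AddSubgroup.closure (↑(insert x s) : Set V) with hC
    set Vp : AddSubgroup V := AddSubgroup.torsionBy V (p : ℤ) with hVp
    have hC'C : C' ≤ C := AddSubgroup.closure_mono (Finset.coe_subset.mpr (Finset.subset_insert x s))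
    have hCR : C ≤ R := (AddSubgroup.closure_le R).mpr hs
    haveI : Finite ↥(C ⊓ Vp) := Finite.of_injective _ (AddSubgroup.inclusion_injective (inf_le_left.trans hCR))
    -- `C = C' ⊔ ℤx`
    have hCsup : C = C' ⊔ AddSubgroup.zmultiples x := by
      rw [hC, hC', Finset.coe_insert, Set.insert_eq, AddSubgroup.closure_union,
        ← AddSubgroup.zmultiples_eq_closure, sup_comm]
    -- count `T = C ∩ V[p]` through `π : V → V/C'`
    set π : V →+ V ⧸ C' := QuotientAddGroup.mk' C' with hπ
    have hkerπ : π.ker = C' := QuotientAddGroup.ker_mk' C'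
    have hcount := natCard_eq_natCard_inf_ker_mul_natCard_map π (C ⊓ Vp)
    have hTker : C ⊓ Vp ⊓ π.ker = C' ⊓ Vp := by
      rw [hkerπ, inf_comm, ← inf_assoc, inf_of_le_left hC'C]
    rw [hTker, hcard'] at hcount
    -- the image is a `p`-torsion subgroup of the cyclic group `π(ℤx)`
    have himage : (C ⊓ Vp).map π ≤ AddSubgroup.zmultiples (π x) := by
      rintro _ ⟨t, ht, rfl⟩
      have htC : t ∈ C' ⊔ AddSubgroup.zmultiples x := hCsup ▸ ht.1
      obtain ⟨c', hc', y, hy, rfl⟩ := AddSubgroup.mem_sup.mp htC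
      rw [AddSubgroup.mem_zmultiples_iff] at hy
      obtain ⟨k, rfl⟩ := hy
      have h0 : π c' = 0 := by rw [← AddMonoidHom.mem_ker, hkerπ]; exact hc'
      rw [map_add, h0, zero_add, map_zsmul]
      exact AddSubgroup.zsmul_mem _ (AddSubgroup.mem_zmultiples _) k
    have hptors : ∀ q ∈ (C ⊓ Vp).map π, p • q = 0 := by
      rintro _ ⟨t, ht, rfl⟩
      rw [← map_nsmul, AddSubgroup.torsionBy.nsmul_iff.mp ht.2, map_zero]
    have hdvd : Nat.card ((C ⊓ Vp).map π) ∣ p := natCard_dvd_of_le_zmultiples_of_nsmul_eq_zero hp himage hptors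
    rcases (Nat.dvd_prime hp).mp hdvd with h1 | hpp
    · refine ⟨d', hd'.trans (Finset.card_le_card (Finset.subset_insert x s)), ?_⟩
      rw [hcount, h1, mul_one]
    · refine ⟨d' + 1, ?_, ?_⟩
      · rw [Finset.card_insert_of_notMem hx]; omega
      · rw [hcount, hpp, pow_succ]

end Rank

end Summit.BirchSwinnertonDyer.BirchSwinnertonDyer.Theorems.GenusExact.PlusDescent
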